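import Literature.NumberTheory.Sieve.QuadraticRootsPrimeModuliDFIGamma0Domain
import HarnessLib

/-!
# `Γ∞∖Γ₀(q)`, coprime pairs, and unfolding to the strip (DFI 1995, Prop. 4, support file)

Topic `Literature/NumberTheory/Sieve`.  Second support file of the elementary proof of
Proposition 4 of W. Duke, J. B. Friedlander, H. Iwaniec, *Equidistribution of roots of a quadratic
congruence to prime moduli*, Ann. of Math. 141 (1995).  The Poincaré series of (14) (p. 428) is a
sum over `σ ∈ Γ∞∖Γ₀(q)`; this file fixes the standard parametrisation of these cosets by
bottom rows and proves the *unfolding to the strip* which computes the `L²`-norm of such a series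
on `Γ₀(q)∖ℍ` (Iwaniec, *Spectral methods*, §3.2, "the unfolding method"):

* `CuspPair q` — the pairs `(c, d) ∈ ℤ²` with `(c, d) = (0, 1)` or `c > 0`, `q ∣ c`, `gcd(c, d) = 1`;
  `CuspPair.toSL p ∈ Γ₀(q)` a matrix with bottom row `(c, d)` (Bézout);
* `decompEquiv` — the bijection `(ε, k, p) ↦ ε T^k σ_p`, `Bool × ℤ × CuspPair q ≃ Γ₀(q)`
  (`Γ₀(q) = ⊔_p Γ∞ σ_p`, `Γ∞ = {±T^k}`);
* `strip = {w : 0 ≤ Re w < 1}` and **`tsum_setLIntegral_cuspPair_eq`**: for measurable `Φ ≥ 0` on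
  `ℍ` with `Φ(w + 1) = Φ(w)` and any fundamental domain `F` of `Γ₀(q)`,
  `∑_p ∫_F Φ(σ_p w) dμ(w) = ∫_strip Φ dμ`; and its real-valued (Bochner) form
  `tsum_setIntegral_cuspPair_eq`.

## References

* W. Duke, J. B. Friedlander, H. Iwaniec, Ann. of Math. (2) 141 (1995), 423–441, (14) p. 428 and
  §3. [cite: DukeFriedlanderIwaniec1995, §§2–3]
* H. Iwaniec, *Spectral Methods of Automorphic Forms*, GSM 53 (2002), §2.3 (stability group `Γ∞`,
  double cosets parametrised by `(c, d)`), §3.2 (unfolding). [cite: Iwaniec2002, §2.3, §3.2]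
-/

noncomputable section

namespace Literature.NumberTheory.Sieve

open _root_.MeasureTheory _root_.UpperHalfPlane _root_.ModularGroup
open _root_.Literature.NumberTheory.Automorphic
open scoped Modular MatrixGroups ENNReal Topology

namespace DFI1995

/-! ### Coprime pairs with `q ∣ c` and the matrices `σ_p` -/

/-- The index set of `Γ∞∖Γ₀(q)`: `(0, 1)` (the identity coset) and the coprime pairs `(c, d)` with
`c > 0`, `q ∣ c`. [cite: Iwaniec2002, §2.3 (after (2.15)), PDF p. 30] -/
def CuspPair (q : ℕ) : Type :=
  {p : ℤ × ℤ // (p.1 = 0 ∧ p.2 = 1) ∨ (0 < p.1 ∧ (q : ℤ) ∣ p.1 ∧ Int.gcd p.1 p.2 = 1)}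

namespace CuspPair

variable {q : ℕ}

/-- `CuspPair q` is countable (a subtype of `ℤ × ℤ`). [folklore] -/
instance : Countable (CuspPair q) := by unfold CuspPair; infer_instance

/-- The lower-left entry `c`. [folklore] -/
def c (p : CuspPair q) : ℤ := p.1.1

/-- The lower-right entry `d`. [folklore] -/
def d (p : CuspPair q) : ℤ := p.1.2

/-- Two pairs are equal iff their entries are. [folklore] -/
theorem ext_iff' {p p' : CuspPair q} : p = p' ↔ p.c = p'.c ∧ p.d = p'.d := by
  constructor
  · rintro rfl; exact ⟨rfl, rfl⟩
  · rintro ⟨h1, h2⟩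
    apply Subtype.ext
    exact Prod.ext h1 h2

/-- `gcd(c, d) = 1`. [folklore] -/
theorem gcd_eq_one (p : CuspPair q) : Int.gcd p.c p.d = 1 := by
  rcases p.2 with ⟨h1, h2⟩ | ⟨-, -, h⟩
  · simp [c, d, h1, h2]
  · exact h

/-- `0 ≤ c`. [folklore] -/
theorem c_nonneg (p : CuspPair q) : 0 ≤ p.c := by
  rcases p.2 with ⟨h1, -⟩ | ⟨h, -, -⟩
  · simp [c, h1]
  · exact le_of_lt h

/-- `q ∣ c`. [folklore] -/
theorem dvd_c (p : CuspPair q) : (q : ℤ) ∣ p.c := by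
  rcases p.2 with ⟨h1, -⟩ | ⟨-, h, -⟩
  · simp [c, h1]
  · exact h

/-- Bézout: `c · gcdA + d · gcdB = 1`. [folklore] -/
theorem bezout (p : CuspPair q) : p.c * Int.gcdA p.c p.d + p.d * Int.gcdB p.c p.d = 1 := by
  have := Int.gcd_eq_gcd_ab p.c p.d
  rw [p.gcd_eq_one] at this
  exact_mod_cast this.symm

/-- The matrix `σ_p = (gcdB, -gcdA; c, d) ∈ SL₂(ℤ)` with bottom row `(c, d)`. [folklore] -/
def toSL (p : CuspPair q) : SL(2, ℤ) :=
  ⟨!![Int.gcdB p.c p.d, -Int.gcdA p.c p.d; p.c, p.d], by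
    rw [Matrix.det_fin_two_of]
    have := p.bezout
    linarith⟩

/-- Lower-left entry of `σ_p`. [folklore] -/
@[simp] theorem toSL_apply_10 (p : CuspPair q) : p.toSL 1 0 = p.c := rfl

/-- Lower-right entry of `σ_p`. [folklore] -/
@[simp] theorem toSL_apply_11 (p : CuspPair q) : p.toSL 1 1 = p.d := rfl

/-- `σ_p ∈ Γ₀(q)`. [folklore] -/
theorem toSL_mem (p : CuspPair q) : p.toSL ∈ CongruenceSubgroup.Gamma0 q := by
  rw [CongruenceSubgroup.Gamma0_mem, toSL_apply_10]
  obtain ⟨k, hk⟩ := p.dvd_c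
  rw [hk]; simp

/-- The identity coset `(0, 1)`. [folklore] -/
def one (q : ℕ) : CuspPair q := ⟨(0, 1), Or.inl ⟨rfl, rfl⟩⟩

/-- A pair with `c > 0`, `q ∣ c`, `gcd(c, d) = 1`. [folklore] -/
def mk' (c d : ℤ) (hc : 0 < c) (hq : (q : ℤ) ∣ c) (hg : Int.gcd c d = 1) : CuspPair q :=
  ⟨(c, d), Or.inr ⟨hc, hq, hg⟩⟩

end CuspPair

/-! ### `Γ₀(q) = ⊔_p {±T^k} σ_p` -/

variable {q : ℕ}

/-- An element of `SL₂(ℤ)` with bottom row `(0, 1)` is `T^b`, `b` its upper-right entry.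
[folklore] -/
theorem eq_T_zpow_of_apply (g : SL(2, ℤ)) (h10 : g 1 0 = 0) (h11 : g 1 1 = 1) :
    g = T ^ (g 0 1 : ℤ) := by
  have hdet := g.det_coe
  rw [Matrix.det_fin_two, h10, h11] at hdet
  have h00 : g 0 0 = 1 := by simpa using hdet
  ext i j
  rw [ModularGroup.coe_T_zpow]
  fin_cases i <;> fin_cases j <;> simp [h00, h10, h11]

/-- The sign action `ε g`, `ε ∈ {+, -} ≅ Bool` (`true ↦ g`, `false ↦ -g`). [folklore] -/
def sgn (b : Bool) (g : SL(2, ℤ)) : SL(2, ℤ) := cond b g (-g)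

/-- `sgn true g = g`. [folklore] -/
@[simp] theorem sgn_true (g : SL(2, ℤ)) : sgn true g = g := rfl

/-- `sgn false g = -g`. [folklore] -/
@[simp] theorem sgn_false (g : SL(2, ℤ)) : sgn false g = -g := rfl

/-- `ε g` acts on `ℍ` as `g`. [folklore] -/
theorem sgn_smul (b : Bool) (g : SL(2, ℤ)) (z : ℍ) : sgn b g • z = g • z := by
  cases b <;> simp [sgn]

/-- The map `(ε, k, p) ↦ ε T^k σ_p`. [folklore] -/
def decomp (q : ℕ) (x : Bool × ℤ × CuspPair q) : SL(2, ℤ) :=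
  sgn x.1 (T ^ x.2.1 * x.2.2.toSL)

/-- `ε T^k σ_p ∈ Γ₀(q)`. [folklore] -/
theorem decomp_mem (x : Bool × ℤ × CuspPair q) : decomp q x ∈ CongruenceSubgroup.Gamma0 q := by
  have hT : T ∈ CongruenceSubgroup.Gamma0 q := by
    rw [CongruenceSubgroup.Gamma0_mem]; simp [ModularGroup.T]
  have h1 : T ^ x.2.1 * x.2.2.toSL ∈ CongruenceSubgroup.Gamma0 q :=
    Subgroup.mul_mem _ (Subgroup.zpow_mem _ hT _) x.2.2.toSL_mem
  rcases x with ⟨b, k, p⟩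
  cases b
  · simp only [decomp, sgn_false]
    have : -(T ^ k * p.toSL) = (-1) * (T ^ k * p.toSL) := by simp
    rw [this]
    exact Subgroup.mul_mem _ neg_one_mem_Gamma0 h1
  · simpa [decomp] using h1

/-- Bottom row of `ε T^k σ_p`: `± (c, d)`. [folklore] -/
theorem decomp_apply_one (x : Bool × ℤ × CuspPair q) :
    (decomp q x) 1 0 = (cond x.1 1 (-1) : ℤ) * x.2.2.c ∧
      (decomp q x) 1 1 = (cond x.1 1 (-1) : ℤ) * x.2.2.d := by
  rcases x with ⟨b, k, p⟩
  have hrow := ModularGroup.T_pow_mul_apply_one k p.toSL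
  have h0 : (T ^ k * p.toSL) 1 0 = p.c := congrFun hrow 0
  have h1 : (T ^ k * p.toSL) 1 1 = p.d := congrFun hrow 1
  cases b
  · simp only [decomp, sgn_false, cond_false]
    constructor
    · show (-(T ^ k * p.toSL) : SL(2, ℤ)) 1 0 = -1 * p.c
      rw [Matrix.SpecialLinearGroup.coe_neg, Matrix.neg_apply, h0]; ring
    · show (-(T ^ k * p.toSL) : SL(2, ℤ)) 1 1 = -1 * p.d
      rw [Matrix.SpecialLinearGroup.coe_neg, Matrix.neg_apply, h1]; ring
  · simp only [decomp, sgn_true, cond_true]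
    exact ⟨by rw [h0]; ring, by rw [h1]; ring⟩

/-- Injectivity of `(ε, k, p) ↦ ε T^k σ_p`. [folklore] -/
theorem decomp_injective : Function.Injective (decomp q) := by
  rintro ⟨b, k, p⟩ ⟨b', k', p'⟩ h
  obtain ⟨h0, h1⟩ := decomp_apply_one (q := q) (b, k, p)
  obtain ⟨h0', h1'⟩ := decomp_apply_one (q := q) (b', k', p')
  simp only at h0 h1 h0' h1'
  rw [h, h0'] at h0
  rw [h, h1'] at h1
  -- `h0 : ε' c' = ε c`, `h1 : ε' d' = ε d`
  have hεabs : ∀ b : Bool, ((cond b 1 (-1) : ℤ)).natAbs = 1 := by intro b; cases b <;> simp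
  have hεne : ∀ b : Bool, (cond b 1 (-1) : ℤ) ≠ 0 := by intro b; cases b <;> simp
  have hcc : p'.c = p.c := by
    have e := congrArg Int.natAbs h0
    simp only [Int.natAbs_mul, hεabs, one_mul] at e
    exact (Int.natAbs_inj_of_nonneg_of_nonneg p'.c_nonneg p.c_nonneg).1 e
  -- the pairs agree
  have hpp : p = p' := by
    rcases p.2 with ⟨hp1, hp2⟩ | ⟨hp1, -, -⟩ <;> rcases p'.2 with ⟨hq1, hq2⟩ | ⟨hq1, -, -⟩
    · exact CuspPair.ext_iff'.2 ⟨hcc.symm, by simp [CuspPair.d, hp2, hq2]⟩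
    · exfalso
      have e1 : p.c = 0 := hp1
      have e2 : (0 : ℤ) < p'.c := hq1
      rw [hcc, e1] at e2
      exact lt_irrefl _ e2
    · exfalso
      have e1 : p'.c = 0 := hq1
      have e2 : (0 : ℤ) < p.c := hp1
      rw [← hcc, e1] at e2
      exact lt_irrefl _ e2
    · have hc0 : (0 : ℤ) < p.c := hp1
      have hbb : (cond b' 1 (-1) : ℤ) = (cond b 1 (-1) : ℤ) := by
        rw [hcc] at h0
        exact mul_right_cancel₀ (ne_of_gt hc0) h0
      refine CuspPair.ext_iff'.2 ⟨hcc.symm, ?_⟩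
      rw [hbb] at h1
      exact (mul_left_cancel₀ (hεne b) h1).symm
  subst hpp
  -- the signs agree (`(c, d) ≠ (0, 0)`)
  have hbb : b = b' := by
    by_contra hne
    have hεε : (cond b' 1 (-1) : ℤ) = -(cond b 1 (-1) : ℤ) := by
      cases b <;> cases b' <;> simp at hne ⊢
    rw [hεε] at h0 h1
    have hc0 : p.c = 0 := by
      have e : (2 * (cond b 1 (-1) : ℤ)) * p.c = 0 := by linarith
      rcases mul_eq_zero.1 e with h' | h'
      · exact absurd (by linarith : (cond b 1 (-1) : ℤ) = 0) (hεne b)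
      · exact h'
    have hd0 : p.d = 0 := by
      have e : (2 * (cond b 1 (-1) : ℤ)) * p.d = 0 := by linarith
      rcases mul_eq_zero.1 e with h' | h'
      · exact absurd (by linarith : (cond b 1 (-1) : ℤ) = 0) (hεne b)
      · exact h'
    have hg := p.gcd_eq_one
    rw [hc0, hd0] at hg
    simp at hg
  subst hbb
  -- then the power of `T`
  have hT : T ^ k = T ^ k' := by
    have h' : T ^ k * p.toSL = T ^ k' * p.toSL := by
      cases b
      · simpa [decomp] using h
      · simpa [decomp] using h
    exact mul_right_cancel h'
  have hk : k = k' := by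
    have := congrArg (fun g : SL(2, ℤ) => g 0 1) hT
    simpa [ModularGroup.coe_T_zpow] using this
  subst hk
  rfl

/-- Surjectivity: every `g ∈ Γ₀(q)` is `ε T^k σ_p`. [cite: Iwaniec2002, §2.3 (Γ∞ and the double cosets), PDF p. 30] -/
theorem exists_decomp_eq {g : SL(2, ℤ)} (hg : g ∈ CongruenceSubgroup.Gamma0 q) :
    ∃ x : Bool × ℤ × CuspPair q, decomp q x = g := by
  have hcop : Int.gcd (g 1 0) (g 1 1) = 1 := by
    have hdet := g.det_coe
    rw [Matrix.det_fin_two] at hdet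
    have : IsCoprime (g 1 0) (g 1 1) := by
      refine ⟨-(g 0 1), g 0 0, ?_⟩
      linarith
    exact Int.isCoprime_iff_gcd_eq_one.1 this
  have hq : (q : ℤ) ∣ g 1 0 := by
    have := CongruenceSubgroup.Gamma0_mem.1 hg
    exact (ZMod.intCast_zmod_eq_zero_iff_dvd _ _).1 this
  by_cases hc : g 1 0 = 0
  · -- `g = ± T^k`
    have hd : g 1 1 = 1 ∨ g 1 1 = -1 := by
      rw [hc, Int.gcd_zero_left] at hcop
      exact Int.natAbs_eq_natAbs_iff.1 (by simpa using hcop) |>.imp id id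
    -- `σ_{(0,1)}` itself is a power of `T`
    set b₀ : ℤ := (CuspPair.one q).toSL 0 1 with hb₀
    have hone : (CuspPair.one q).toSL = T ^ b₀ := eq_T_zpow_of_apply _ rfl rfl
    rcases hd with hd | hd
    · refine ⟨(true, g 0 1 - b₀, CuspPair.one q), ?_⟩
      simp only [decomp, sgn_true]
      rw [hone, ← zpow_add, sub_add_cancel]
      exact (eq_T_zpow_of_apply g hc hd).symm
    · refine ⟨(false, (-g) 0 1 - b₀, CuspPair.one q), ?_⟩
      simp only [decomp, sgn_false]
      rw [hone, ← zpow_add, sub_add_cancel]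
      have := eq_T_zpow_of_apply (-g) (by simp [hc]) (by simp [hd])
      rw [← this, neg_neg]
  · -- `c ≠ 0`: normalise the sign of `c`
    obtain hpos | hneg := lt_or_gt_of_ne hc
    · -- `c < 0`: use `-g`
      set p : CuspPair q := CuspPair.mk' (-(g 1 0)) (-(g 1 1)) (by linarith) (by simpa using hq)
        (by simpa using hcop) with hp
      -- `(-g) σ_p⁻¹` has bottom row `(0, 1)`
      set u : SL(2, ℤ) := -g * p.toSL⁻¹ with hu
      have hu10 : u 1 0 = 0 := by
        simp [hu, Matrix.SpecialLinearGroup.coe_inv, Matrix.adjugate_fin_two, Matrix.mul_apply,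
          Fin.sum_univ_two, CuspPair.toSL, p, CuspPair.mk', CuspPair.c, CuspPair.d]
        ring
      have hu11 : u 1 1 = 1 := by
        have hb := p.bezout
        simp only [p, CuspPair.mk', CuspPair.c, CuspPair.d] at hb
        simp [hu, Matrix.SpecialLinearGroup.coe_inv, Matrix.adjugate_fin_two, Matrix.mul_apply,
          Fin.sum_univ_two, CuspPair.toSL, p, CuspPair.mk', CuspPair.c, CuspPair.d]
        linarith
      refine ⟨(false, u 0 1, p), ?_⟩
      simp only [decomp, sgn_false]
      rw [← eq_T_zpow_of_apply u hu10 hu11, hu]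
      simp
    · set p : CuspPair q := CuspPair.mk' (g 1 0) (g 1 1) hneg hq hcop with hp
      set u : SL(2, ℤ) := g * p.toSL⁻¹ with hu
      have hu10 : u 1 0 = 0 := by
        simp [hu, Matrix.SpecialLinearGroup.coe_inv, Matrix.adjugate_fin_two, Matrix.mul_apply,
          Fin.sum_univ_two, CuspPair.toSL, p, CuspPair.mk', CuspPair.c, CuspPair.d]
        ring
      have hu11 : u 1 1 = 1 := by
        have hb := p.bezout
        simp only [p, CuspPair.mk', CuspPair.c, CuspPair.d] at hb
        simp [hu, Matrix.SpecialLinearGroup.coe_inv, Matrix.adjugate_fin_two, Matrix.mul_apply,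
          Fin.sum_univ_two, CuspPair.toSL, p, CuspPair.mk', CuspPair.c, CuspPair.d]
        linarith
      refine ⟨(true, u 0 1, p), ?_⟩
      simp only [decomp, sgn_true]
      rw [← eq_T_zpow_of_apply u hu10 hu11, hu]
      simp

/-- **`Bool × ℤ × CuspPair q ≃ Γ₀(q)`**, `(ε, k, p) ↦ ε T^k σ_p`: the decomposition
`Γ₀(q) = ⊔_{(c,d)} Γ∞ σ_{(c,d)}`, `Γ∞ = {±T^k}`. [cite: Iwaniec2002, §2.3, PDF p. 30] -/
def decompEquiv (q : ℕ) : Bool × ℤ × CuspPair q ≃ CongruenceSubgroup.Gamma0 q :=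
  Equiv.ofBijective (fun x => ⟨decomp q x, decomp_mem x⟩)
    ⟨fun x y h => decomp_injective (congrArg Subtype.val h),
     fun g => by
      obtain ⟨x, hx⟩ := exists_decomp_eq g.2
      exact ⟨x, Subtype.ext hx⟩⟩

/-- `decompEquiv` is `decomp` on the nose. [folklore] -/
@[simp] theorem decompEquiv_apply (x : Bool × ℤ × CuspPair q) :
    ((decompEquiv q x : CongruenceSubgroup.Gamma0 q) : SL(2, ℤ)) = decomp q x := rfl

/-- The same bijection onto `Gamma0GL q ≤ GL₂(ℝ)`. [folklore] -/
def decompEquivGL (q : ℕ) : Bool × ℤ × CuspPair q ≃ Gamma0GL q :=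
  (decompEquiv q).trans
    ((CongruenceSubgroup.Gamma0 q).equivMapOfInjective _ mapGL_injective).toEquiv

/-- `decompEquivGL` is `mapGL ∘ decomp`. [folklore] -/
theorem decompEquivGL_apply (x : Bool × ℤ × CuspPair q) :
    ((decompEquivGL q x : Gamma0GL q) : GL (Fin 2) ℝ) =
      Matrix.SpecialLinearGroup.mapGL ℝ (decomp q x) := by
  change ((((CongruenceSubgroup.Gamma0 q).equivMapOfInjective _ mapGL_injective)
    (decompEquiv q x) : Gamma0GL q) : GL (Fin 2) ℝ) = _
  rw [Subgroup.coe_equivMapOfInjective_apply]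
  rfl

/-- Action of `ε T^k σ_p` on `ℍ`: `T^k (σ_p w)`. [folklore] -/
theorem decompEquivGL_smul (x : Bool × ℤ × CuspPair q) (w : ℍ) :
    ((decompEquivGL q x : Gamma0GL q) : GL (Fin 2) ℝ) • w = T ^ x.2.1 • (x.2.2.toSL • w) := by
  rw [decompEquivGL_apply]
  change (decomp q x) • w = _
  rw [decomp, sgn_smul, mul_smul]

/-! ### The strip and unfolding -/

/-- The strip `{w ∈ ℍ : 0 ≤ Re w < 1}`, a fundamental domain for the translations `w ↦ w + k`.
[cite: Iwaniec2002, §3.2 (unfolding to `Γ∞∖ℍ`), PDF p. 42] -/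
def strip : Set ℍ := {w : ℍ | w.re ∈ Set.Ico (0 : ℝ) 1}

/-- The strip is measurable. [folklore] -/
theorem measurableSet_strip : MeasurableSet strip :=
  (measurableSet_Ico).preimage (continuous_re.measurable)

/-- Exactly one integer translate of any point lies in the strip. [folklore] -/
theorem tsum_indicator_strip_T_zpow_smul (v : ℍ) :
    ∑' k : ℤ, strip.indicator (1 : ℍ → ℝ≥0∞) (T ^ k • v) = 1 := by
  have key : ∀ k : ℤ, (T ^ k • v ∈ strip ↔ k = -⌊v.re⌋) := by
    intro k
    simp only [strip, Set.mem_setOf_eq, Set.mem_Ico, re_T_zpow_smul]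
    constructor
    · rintro ⟨h1, h2⟩
      have : ⌊v.re + k⌋ = 0 := Int.floor_eq_zero_iff.2 ⟨h1, h2⟩
      rw [Int.floor_add_intCast] at this
      omega
    · rintro rfl
      push_cast
      constructor
      · linarith [Int.floor_le v.re]
      · linarith [Int.lt_floor_add_one v.re]
  rw [tsum_eq_single (-⌊v.re⌋)]
  · rw [Set.indicator_of_mem ((key _).2 rfl)]; rfl
  · intro k hk
    exact Set.indicator_of_notMem (fun h => hk ((key k).1 h)) _

/-- **Unfolding to the strip (Lebesgue integral)**: for measurable `Φ ≥ 0` on `ℍ` invariant under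
`w ↦ w + 1` and a fundamental domain `F` of `Γ₀(q)`,
`∑_{p} ∫_F Φ(σ_p w) dμ(w) = ∫_{strip} Φ dμ` — the translates `σ F`, `σ ∈ Γ∞∖Γ₀(q)`, tile the
strip `Γ∞∖ℍ`. [cite: Iwaniec2002, §3.2 (3.11)–(3.12), PDF p. 42] -/
theorem tsum_setLIntegral_cuspPair_eq {F : Set ℍ} (hF : IsHypFundamentalDomain (Gamma0GL q) F)
    {Φ : ℍ → ℝ≥0∞} (hΦ : Measurable Φ) (hper : ∀ w : ℍ, Φ (T • w) = Φ w) :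
    ∑' p : CuspPair q, ∫⁻ w in F, Φ (p.toSL • w) = ∫⁻ w in strip, Φ w := by
  -- periodicity under all powers of `T`
  have hnat : ∀ (n : ℕ) (w : ℍ), Φ (T ^ (n : ℤ) • w) = Φ w := by
    intro n
    induction n with
    | zero => intro w; simp
    | succ n ih => intro w; rw [Nat.cast_succ, zpow_add_one, mul_smul, ih, hper]
  have hperk : ∀ (k : ℤ) (w : ℍ), Φ (T ^ k • w) = Φ w := by
    intro k w
    obtain ⟨n, rfl | rfl⟩ := Int.eq_nat_or_neg k
    · exact hnat n w
    · have := hnat n (T ^ (-(n : ℤ)) • w)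
      rw [← mul_smul, ← zpow_add, add_neg_cancel, zpow_zero, one_smul] at this
      exact this.symm
  -- unfold `2 ∫_strip Φ = Σ_γ ∫_F (𝟙_strip Φ)(γ w)` over `Γ₀(q)`
  set φ : ℍ → ℝ≥0∞ := fun w => strip.indicator (1 : ℍ → ℝ≥0∞) w * Φ w with hφdef
  have hφm : Measurable φ := (measurable_one.indicator measurableSet_strip).mul hΦ
  have hunf := tsum_setLIntegral_smul_eq Gamma0GL_le_range_toGL neg_one_mem_Gamma0GL
    countable_Gamma0GL hF hφm.aemeasurable
  have hrhs : ∫⁻ w, φ w = ∫⁻ w in strip, Φ w := by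
    rw [← lintegral_indicator measurableSet_strip]
    congr 1; funext w
    by_cases hw : w ∈ strip
    · simp [hφdef, Set.indicator_of_mem hw]
    · simp [hφdef, Set.indicator_of_notMem hw]
  rw [hrhs] at hunf
  -- reindex the sum over `Γ₀(q)` by `(ε, k, p)`
  rw [← (decompEquivGL q).tsum_eq] at hunf
  simp_rw [decompEquivGL_smul] at hunf
  simp_rw [ENNReal.tsum_prod'] at hunf
  -- the summand does not depend on `ε`; the `k`-sum of the strip indicators is `1`
  have hinner : ∀ (b : Bool) (p : CuspPair q),
      ∑' k : ℤ, ∫⁻ w in F, φ (T ^ k • (p.toSL • w)) = ∫⁻ w in F, Φ (p.toSL • w) := by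
    intro b p
    have hmk : ∀ k : ℤ, AEMeasurable (fun w => φ (T ^ k • (p.toSL • w))) (volume.restrict F) := by
      intro k
      refine (hφm.comp ?_).aemeasurable
      change Measurable fun w : ℍ => ((T ^ k : SL(2, ℤ)) : GL (Fin 2) ℝ) • (((p.toSL : SL(2, ℤ)) : GL (Fin 2) ℝ) • w)
      exact (measurable_const_smul _).comp (measurable_const_smul _)
    rw [← lintegral_tsum hmk]
    congr 1; funext w
    simp only [hφdef]
    simp_rw [hperk]
    rw [ENNReal.tsum_mul_right, tsum_indicator_strip_T_zpow_smul, one_mul]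
  have hinner' : ∀ a : Bool, ∑' (k : ℤ) (p : CuspPair q), ∫⁻ w in F, φ (T ^ k • (p.toSL • w)) =
      ∑' p : CuspPair q, ∫⁻ w in F, Φ (p.toSL • w) := by
    intro a
    rw [ENNReal.tsum_comm]
    exact tsum_congr fun p => hinner a p
  have hunf' : ∑' (_ : Bool), ∑' p : CuspPair q, ∫⁻ w in F, Φ (p.toSL • w) =
      2 * ∫⁻ w in strip, Φ w := (tsum_congr hinner').symm.trans hunf
  rw [tsum_bool] at hunf'
  -- `hunf' : S + S = 2 * ∫_strip Φ`
  have h2 : (2 : ℝ≥0∞) * ∑' p : CuspPair q, ∫⁻ w in F, Φ (p.toSL • w) = 2 * ∫⁻ w in strip, Φ w := by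
    rw [two_mul]; exact hunf'
  have := congrArg (fun x : ℝ≥0∞ => 2⁻¹ * x) h2
  simpa only [← mul_assoc, ENNReal.inv_mul_cancel (two_ne_zero) (ENNReal.ofNat_ne_top), one_mul]
    using this

/-- **Unfolding to the strip (real-valued, Bochner integral)**: for measurable `Ψ : ℍ → ℝ` with
`Ψ(w + 1) = Ψ(w)` and `∫_{strip} |Ψ| dμ < ∞`, and a fundamental domain `F` of `Γ₀(q)`, each
`w ↦ Ψ(σ_p w)` is integrable on `F`, the integrals are absolutely summable, and
`∑_p ∫_F Ψ(σ_p w) dμ(w) = ∫_{strip} Ψ dμ`. [cite: Iwaniec2002, §3.2 (3.11)–(3.12), PDF p. 42] -/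
theorem tsum_setIntegral_cuspPair_eq {F : Set ℍ} (hF : IsHypFundamentalDomain (Gamma0GL q) F)
    {Ψ : ℍ → ℝ} (hΨ : Measurable Ψ) (hper : ∀ w : ℍ, Ψ (T • w) = Ψ w)
    (hfin : ∫⁻ w in strip, ‖Ψ w‖ₑ < ∞) :
    (∀ p : CuspPair q, Integrable (fun w => Ψ (p.toSL • w)) (volume.restrict F)) ∧
    Summable (fun p : CuspPair q => ∫ w in F, Ψ (p.toSL • w)) ∧
    ∑' p : CuspPair q, ∫ w in F, Ψ (p.toSL • w) = ∫ w in strip, Ψ w := by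
  have hmeas_smul : ∀ p : CuspPair q, Measurable fun w : ℍ => p.toSL • w := fun p => by
    change Measurable fun w : ℍ => (((p.toSL : SL(2, ℤ)) : GL (Fin 2) ℝ)) • w
    exact measurable_const_smul _
  -- positive and negative parts
  set Ψp : ℍ → ℝ := fun w => max (Ψ w) 0 with hΨp
  set Ψn : ℍ → ℝ := fun w => max (-Ψ w) 0 with hΨn
  have hΨp_m : Measurable Ψp := hΨ.max measurable_const
  have hΨn_m : Measurable Ψn := hΨ.neg.max measurable_const
  have hdecomp : ∀ w, Ψ w = Ψp w - Ψn w := fun w => by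
    simp only [hΨp, hΨn]; rcases le_total 0 (Ψ w) with h | h
    · rw [max_eq_left h, max_eq_right (by linarith)]; ring
    · rw [max_eq_right h, max_eq_left (by linarith)]; ring
  have hΨp_le : ∀ w, ‖Ψp w‖ₑ ≤ ‖Ψ w‖ₑ := fun w => by
    simp only [hΨp]
    rw [Real.enorm_eq_ofReal (le_max_right _ _), Real.enorm_eq_ofReal_abs]
    exact ENNReal.ofReal_le_ofReal (max_le (le_abs_self _) (abs_nonneg _))
  have hΨn_le : ∀ w, ‖Ψn w‖ₑ ≤ ‖Ψ w‖ₑ := fun w => by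
    simp only [hΨn]
    rw [Real.enorm_eq_ofReal (le_max_right _ _), Real.enorm_eq_ofReal_abs]
    exact ENNReal.ofReal_le_ofReal (max_le (neg_le_abs _) (abs_nonneg _))
  -- the generic statement for a nonnegative part `G`
  have hpart : ∀ G : ℍ → ℝ, Measurable G → (∀ w, 0 ≤ G w) → (∀ w, G (T • w) = G w) →
      (∀ w, ‖G w‖ₑ ≤ ‖Ψ w‖ₑ) →
      (∀ p : CuspPair q, Integrable (fun w => G (p.toSL • w)) (volume.restrict F)) ∧
      Summable (fun p : CuspPair q => ∫ w in F, G (p.toSL • w)) ∧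
      ∑' p : CuspPair q, ∫ w in F, G (p.toSL • w) = ∫ w in strip, G w := by
    intro G hGm hG0 hGper hGle
    have hL := tsum_setLIntegral_cuspPair_eq hF (Φ := fun w => ‖G w‖ₑ) hGm.enorm
      (fun w => by rw [hGper w])
    have hLfin : ∫⁻ w in strip, ‖G w‖ₑ < ∞ :=
      lt_of_le_of_lt (lintegral_mono fun w => hGle w) hfin
    have hterm_fin : ∀ p : CuspPair q, ∫⁻ w in F, ‖G (p.toSL • w)‖ₑ < ∞ := by
      intro p
      refine lt_of_le_of_lt ?_ hLfin
      rw [← hL]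
      exact ENNReal.le_tsum p
    have hint : ∀ p : CuspPair q, Integrable (fun w => G (p.toSL • w)) (volume.restrict F) :=
      fun p => ⟨(hGm.comp (hmeas_smul p)).aestronglyMeasurable, hterm_fin p⟩
    -- integrals of nonnegative functions as `toReal` of lintegrals
    have heq : ∀ p : CuspPair q, ∫ w in F, G (p.toSL • w) =
        (∫⁻ w in F, ‖G (p.toSL • w)‖ₑ).toReal := by
      intro p
      rw [integral_eq_lintegral_of_nonneg_ae (Filter.Eventually.of_forall fun w => hG0 _)
        (hGm.comp (hmeas_smul p)).aestronglyMeasurable]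
      congr 1
      apply lintegral_congr
      intro w
      rw [Real.enorm_eq_ofReal (hG0 _)]
    have heq' : ∫ w in strip, G w = (∫⁻ w in strip, ‖G w‖ₑ).toReal := by
      rw [integral_eq_lintegral_of_nonneg_ae (Filter.Eventually.of_forall fun w => hG0 _)
        hGm.aestronglyMeasurable]
      congr 1
      apply lintegral_congr
      intro w
      rw [Real.enorm_eq_ofReal (hG0 _)]
    refine ⟨hint, ?_, ?_⟩
    · simp_rw [heq]
      exact ENNReal.summable_toReal (by rw [hL]; exact hLfin.ne)
    · simp_rw [heq]
      rw [← ENNReal.tsum_toReal_eq (fun p => (hterm_fin p).ne), hL, heq']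
  obtain ⟨hip, hsp, hep⟩ := hpart Ψp hΨp_m (fun w => le_max_right _ _)
    (fun w => by simp only [hΨp]; rw [hper w]) hΨp_le
  obtain ⟨hin, hsn, hen⟩ := hpart Ψn hΨn_m (fun w => le_max_right _ _)
    (fun w => by simp only [hΨn]; rw [hper w]) hΨn_le
  have hfun : ∀ p : CuspPair q, (fun w => Ψ (p.toSL • w)) =
      fun w => Ψp (p.toSL • w) - Ψn (p.toSL • w) := fun p => by funext w; exact hdecomp _
  refine ⟨fun p => by rw [hfun p]; exact (hip p).sub (hin p), ?_, ?_⟩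
  · have : (fun p : CuspPair q => ∫ w in F, Ψ (p.toSL • w)) =
        fun p => (∫ w in F, Ψp (p.toSL • w)) - ∫ w in F, Ψn (p.toSL • w) := by
      funext p; rw [hfun p, integral_sub (hip p) (hin p)]
    rw [this]; exact hsp.sub hsn
  · have : ∀ p : CuspPair q, ∫ w in F, Ψ (p.toSL • w) =
        (∫ w in F, Ψp (p.toSL • w)) - ∫ w in F, Ψn (p.toSL • w) := by
      intro p; rw [hfun p, integral_sub (hip p) (hin p)]
    simp_rw [this]
    rw [hsp.tsum_sub hsn, hep, hen]
    -- `∫_strip Ψ = ∫_strip Ψ⁺ - ∫_strip Ψ⁻`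
    have hintp : Integrable Ψp (volume.restrict strip) :=
      ⟨hΨp_m.aestronglyMeasurable, lt_of_le_of_lt (lintegral_mono fun w => hΨp_le w) hfin⟩
    have hintn : Integrable Ψn (volume.restrict strip) :=
      ⟨hΨn_m.aestronglyMeasurable, lt_of_le_of_lt (lintegral_mono fun w => hΨn_le w) hfin⟩
    rw [← integral_sub hintp hintn]
    congr 1; funext w; exact (hdecomp w).symm

/-- **Unfolding to the strip, swapped form**: under the hypotheses of
`tsum_setIntegral_cuspPair_eq`, `∫_F ∑_p Ψ(σ_p w) dμ(w) = ∫_{strip} Ψ dμ`, the series being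
(absolutely) integrable termwise. [cite: Iwaniec2002, §3.2 (3.11)–(3.12), PDF p. 42] -/
theorem setIntegral_tsum_cuspPair_eq {F : Set ℍ} (hF : IsHypFundamentalDomain (Gamma0GL q) F)
    {Ψ : ℍ → ℝ} (hΨ : Measurable Ψ) (hper : ∀ w : ℍ, Ψ (T • w) = Ψ w)
    (hfin : ∫⁻ w in strip, ‖Ψ w‖ₑ < ∞) :
    ∫ w in F, ∑' p : CuspPair q, Ψ (p.toSL • w) = ∫ w in strip, Ψ w := by
  have hmeas_smul : ∀ p : CuspPair q, Measurable fun w : ℍ => p.toSL • w := fun p => by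
    change Measurable fun w : ℍ => (((p.toSL : SL(2, ℤ)) : GL (Fin 2) ℝ)) • w
    exact measurable_const_smul _
  have hL := tsum_setLIntegral_cuspPair_eq hF (Φ := fun w => ‖Ψ w‖ₑ) hΨ.enorm
    (fun w => by rw [hper w])
  have key := integral_tsum (μ := volume.restrict F) (f := fun (p : CuspPair q) (w : ℍ) => Ψ (p.toSL • w))
    (fun p => (hΨ.comp (hmeas_smul p)).aestronglyMeasurable) (by rw [hL]; exact hfin.ne)
  rw [key]
  exact (tsum_setIntegral_cuspPair_eq hF hΨ hper hfin).2.2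

end DFI1995

end Literature.NumberTheory.Sieve
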